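import Mathlib
import Literature.Analysis.FluidPDE.SuitableWeak
import Literature.Analysis.FluidPDE.WeakSolution
import Summits.NavierStokesRegularity.NavierStokesRegularity.Theorems.EulerZoomLiouvillePowerGaugeEulerLiouvillePeriodicTools
import Literature.Analysis.FluidPDE.Seregin2023.TypeIIEulerZoom
import Summits.NavierStokesRegularity.NavierStokesRegularity.Theorems.TypeILiouvilleTypeIliouvilleNoTypeIIPowerGaugeSteady
import HarnessLib

/-!
# The TIME-PERIODIC stratum of the crux `EulerZoomLiouville.PowerGaugeEulerLiouville`

Route `EulerZoomLiouville` (NavierStokesRegularity), crux E = stmt-NavierStokesRegularity-19832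
`PowerGaugeEulerLiouville`: an ancient local-energy Euler flow `(u, p)` on `(−∞, 0) × ℝ³` (suitable weak,
`ν = 0`, `f = 0`, weak spatial gradient `H`) in Seregin's power-gauged class
`a^{2ρ} A(a) + a^{ρ} E(a) + a^{2ρ} D(a) ≤ c` (all `a > 0`) vanishes a.e.  The crux is OPEN on the window
`0 < ρ ≤ 1/2`; the lead's line (`Cruxes/PowerGaugeEulerLiouville/Lines/birth.lean`) meters progress on
its open core stub through STRATA.  This file lands the TIME-PERIODIC stratum, generalising the steady
stratum (`powerGaugeEulerLiouville_steady`, ns-typeII-p1, p474446) from "every period" to "some period"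
(the first three bullets live in the companion `…PeriodicTools.lean`):

* `const_slice_eq_zero_of_scaledLocalEnergyBound` — a slice `u t` (`t < 0`) which is a.e. constant is
  zero under the scaled local-energy bound `∫_{B(a)} |u(s)|² ≤ c a^{m₁}` (`m₁ < 3`; here `m₁ = 1 − 2ρ`);
* `lintegral_window_ball_le_of_gaugeE` — `a^ρ E(a) ≤ c`, `R ≤ a` ⇒ `∫∫_{(−a²,0)×B_R} |H|²_F ≤ c a^{1−ρ}`;
* `lintegral_Ioo_shift`, `mul_le_lintegral_of_period_windows`, `Iio_subset_iUnion_period_windows`,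
  `lintegral_Iio_eq_zero_of_period_windows`, `setLIntegral_prod_eq` — time-window bookkeeping
  (translation invariance, `N` disjoint period windows inside `(−NP, 0)`, the countable set of period
  endpoints is null, Tonelli on rectangles);
* `weakGradient_ae_zero_of_gaugeE_periodic` — **a time-periodic gradient field with the gauged
  `E`-bound vanishes a.e.** (`ρ > −1`): the `N` period windows in `(−NP, 0) × B_R` carry equal mass
  `J_R`, so `N J_R ≤ c (NP)^{(1−ρ)/2}`; since `(1−ρ)/2 < 1`, `J_R = 0`;
* `ae_eq_zero_of_gauge_of_periodicGradient` — hence (slices a.e. constant by the tree's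
  `PowerGaugeSteady.ae_slice_const_of_weakGradient_ae_zero`, constants killed by the `A`-gauge) **a
  member whose weak gradient is time-periodic vanishes a.e., every `ρ > −1`**;
* `powerGaugeEulerLiouville_periodic` — the same in the crux's binder shape (crux VERBATIM plus
  `∃ P > 0, H(t − P) = H(t)` for `t < 0`).

Only the `E`- and `A`-gauges are used — no Euler equation, pressure or local energy inequality (as for
the steady stratum: on periodic members the gauges decide by themselves, the enstrophy weight `a^{ρ−1}`
per unit time being summed over `~a²/P` periods).  WHAT THIS IS NOT: not NS regularity, not the crux and
not its open core (self-similar / DSS collapse is not time-periodic); a kernel-checked stratum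
`--supports` stmt-19832. [folklore]
-/

noncomputable section

set_option linter.dupNamespace false

open MeasureTheory Set Filter Topology Metric Function TopologicalSpace
open scoped ENNReal NNReal InnerProductSpace RealInnerProductSpace

namespace Summit.NavierStokesRegularity.NavierStokesRegularity.Theorems.PowerGaugeEulerLiouville

open Literature.Analysis Literature.Analysis.FunctionSpaces Literature.Analysis.FluidPDE
open Summit.NavierStokesRegularity.NavierStokesRegularity.Theorems.TypeIliouvilleNoTypeII

/-! ## The periodic stratum: a time-periodic weak gradient with the gauged `E`-bound vanishes -/

/-- **A time-periodic gradient field with the gauged `E`-bound vanishes a.e.** (`ρ > −1`).  Let `H` be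
locally integrable on the slab `(−∞,0) × ℝ³`, time-periodic (`H(t − P, ·) = H(t, ·)` for `t < 0`,
`P > 0`) with `a^ρ E(H; Q_a(0)) ≤ c` for all `a > 0`.  Then `H = 0` a.e. on the slab: the `N` period
windows inside `(−NP, 0) × B_R` all carry the same mass `J_R`, so `N · J_R ≤ c (NP)^{(1−ρ)/2}`, and
`(1−ρ)/2 < 1` forces `J_R = 0`. [folklore] -/
theorem weakGradient_ae_zero_of_gaugeE_periodic {ρ : ℝ} (hρ : -1 < ρ)
    {H : ℝ → EuclideanSpace ℝ (Fin 3) → EuclideanSpace ℝ (Fin 3) →L[ℝ] EuclideanSpace ℝ (Fin 3)}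
    (hHmeas : AEStronglyMeasurable (uncurry H)
      (volume.restrict (Iio (0 : ℝ) ×ˢ (univ : Set (EuclideanSpace ℝ (Fin 3))))))
    {c : ℝ≥0}
    (hE : ∀ a : ℝ, 0 < a →
      ENNReal.ofReal (a ^ ρ) * cknE a (0 : ℝ × EuclideanSpace ℝ (Fin 3)) H ≤ (c : ℝ≥0∞))
    {P : ℝ} (hP : 0 < P) (hper : ∀ t : ℝ, t < 0 → ∀ x, H (t - P) x = H t x) :
    ∀ᵐ z ∂(volume.restrict (Iio (0 : ℝ) ×ˢ (univ : Set (EuclideanSpace ℝ (Fin 3))))), H z.1 z.2 = 0 := by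
  -- the density `F = |H|²_F` and its ball slices `G R t`
  set F : ℝ × EuclideanSpace ℝ (Fin 3) → ℝ≥0∞ := fun q => ENNReal.ofReal (frobeniusNormSq (H q.1 q.2))
    with hFdef
  have hFmeas : AEMeasurable F (volume.restrict (Iio (0 : ℝ) ×ˢ (univ : Set (EuclideanSpace ℝ (Fin 3))))) :=
    ((ENNReal.continuous_ofReal.comp LerayHopfProofs.continuous_frobeniusNormSq).comp_aestronglyMeasurable
      hHmeas).aemeasurable
  have hFmeas' : ∀ (I : Set ℝ) (B : Set (EuclideanSpace ℝ (Fin 3))), I ⊆ Iio 0 →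
      AEMeasurable F (volume.restrict (I ×ˢ B)) := fun I B hI =>
    hFmeas.mono_measure (Measure.restrict_mono (prod_mono hI (subset_univ _)) le_rfl)
  set G : ℝ → ℝ → ℝ≥0∞ := fun R t => ∫⁻ x in ball (0 : EuclideanSpace ℝ (Fin 3)) R, F (t, x) with hGdef
  -- periodicity of the slices
  have hGper : ∀ R : ℝ, ∀ k : ℕ, ∀ t : ℝ, t < 0 → G R (t - (k : ℝ) * P) = G R t := by
    intro R k
    induction k with
    | zero => intro t _; simp
    | succ k ih =>
      intro t ht
      have h1 : t - ((k : ℝ) + 1) * P = (t - (k : ℝ) * P) - P := by ring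
      have h2 : t - (k : ℝ) * P < 0 := by
        have : 0 ≤ (k : ℝ) * P := by positivity
        linarith
      push_cast
      rw [h1]
      have h3 : G R (t - (k : ℝ) * P - P) = G R (t - (k : ℝ) * P) := by
        simp only [hGdef, hFdef]
        refine lintegral_congr fun x => ?_
        rw [hper _ h2 x]
      rw [h3, ih t ht]
  -- every period window carries the mass of the first one
  have hJ : ∀ R : ℝ, ∀ k : ℕ,
      ∫⁻ t in Ioo (-(((k : ℝ) + 1) * P)) (-((k : ℝ) * P)), G R t = ∫⁻ t in Ioo (-P) 0, G R t := by
    intro R k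
    have e1 : Ioo (-(((k : ℝ) + 1) * P)) (-((k : ℝ) * P)) = Ioo (-P - (k : ℝ) * P) (0 - (k : ℝ) * P) := by
      congr 1 <;> ring
    rw [e1, lintegral_Ioo_shift]
    refine setLIntegral_congr_fun measurableSet_Ioo fun t ht => ?_
    exact hGper R k t ht.2
  -- the window bound from the `E`-gauge: `N · J_R ≤ c (NP)^{(1-ρ)/2}` once `NP ≥ R²`
  have hJzero : ∀ R : ℝ, 0 < R → ∫⁻ t in Ioo (-P) 0, G R t = 0 := by
    intro R hR
    set J := ∫⁻ t in Ioo (-P) 0, G R t with hJdef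
    have hNJ : ∀ N : ℕ, R ^ 2 ≤ (N : ℝ) * P →
        (N : ℝ≥0∞) * J ≤ ENNReal.ofReal (c * ((N : ℝ) * P) ^ ((1 - ρ) / 2)) := by
      intro N hN
      have hNP : 0 < (N : ℝ) * P := lt_of_lt_of_le (by positivity) hN
      set a : ℝ := Real.sqrt ((N : ℝ) * P) with ha
      have ha0 : 0 < a := Real.sqrt_pos.2 hNP
      have ha2 : a ^ 2 = (N : ℝ) * P := Real.sq_sqrt hNP.le
      have hRa : R ≤ a := by
        rw [ha, ← Real.sqrt_sq hR.le]
        exact Real.sqrt_le_sqrt hN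
      have h1 := mul_le_lintegral_of_period_windows hP (hJ R) N
      have h2 : ∫⁻ t in Ioo (-((N : ℝ) * P)) 0, G R t =
          ∫⁻ q in Ioo (-(a ^ 2)) 0 ×ˢ ball (0 : EuclideanSpace ℝ (Fin 3)) R, F q := by
        rw [ha2, setLIntegral_prod_eq (hFmeas' _ _ fun t ht => ht.2)]
      have h3 := lintegral_window_ball_le_of_gaugeE hE ha0 hRa
      have h4 : a ^ (1 - ρ) = ((N : ℝ) * P) ^ ((1 - ρ) / 2) := by
        rw [ha, Real.sqrt_eq_rpow, ← Real.rpow_mul hNP.le]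
        congr 1; ring
      rw [h2] at h1
      rw [h4] at h3
      exact h1.trans h3
    -- `J = ⊤` is impossible, and for `J < ⊤` the bound tends to zero after dividing by `N`
    by_contra hJne
    have hlim : Tendsto (fun N : ℕ => ENNReal.ofReal (c * ((N : ℝ) * P) ^ ((1 - ρ) / 2)) / (N : ℝ≥0∞))
        atTop (𝓝 0) := by
      -- `= ofReal (c P^{(1-ρ)/2} N^{(1-ρ)/2 - 1})` for `N ≥ 1`
      have h1 : Tendsto (fun N : ℕ => c * P ^ ((1 - ρ) / 2) * (N : ℝ) ^ ((1 - ρ) / 2 - 1)) atTop (𝓝 0) := by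
        have h2 : Tendsto (fun x : ℝ => x ^ ((1 - ρ) / 2 - 1)) atTop (𝓝 0) := by
          have := tendsto_rpow_neg_atTop (y := 1 - (1 - ρ) / 2) (by linarith)
          refine this.congr fun x => ?_
          congr 1; ring
        simpa using (h2.comp tendsto_natCast_atTop_atTop).const_mul (c * P ^ ((1 - ρ) / 2))
      have h3 := ENNReal.tendsto_ofReal h1
      rw [ENNReal.ofReal_zero] at h3
      refine (tendsto_congr' ?_).2 h3
      filter_upwards [eventually_ge_atTop 1] with N hN
      have hN0 : 0 < (N : ℝ) := by exact_mod_cast hN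
      rw [show ((N : ℕ) : ℝ≥0∞) = ENNReal.ofReal (N : ℝ) by simp,
        ← ENNReal.ofReal_div_of_pos hN0]
      congr 1
      rw [Real.mul_rpow hN0.le hP.le, Real.rpow_sub_one hN0.ne']
      field_simp
    have hev : ∀ᶠ N : ℕ in atTop, J ≤ ENNReal.ofReal (c * ((N : ℝ) * P) ^ ((1 - ρ) / 2)) / (N : ℝ≥0∞) := by
      have ht : Tendsto (fun N : ℕ => (N : ℝ) * P) atTop atTop :=
        tendsto_natCast_atTop_atTop.atTop_mul_const hP
      filter_upwards [ht.eventually_ge_atTop (R ^ 2), eventually_ge_atTop 1] with N hN hN1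
      have h := hNJ N hN
      rw [ENNReal.le_div_iff_mul_le (Or.inl (by exact_mod_cast (by omega : N ≠ 0)))
        (Or.inl (ENNReal.natCast_ne_top N)), mul_comm]
      exact h
    have hle : J ≤ 0 := ge_of_tendsto hlim hev
    exact hJne (le_antisymm hle bot_le)
  -- hence `∫_{(-∞,0)} G R = 0`, i.e. `F = 0` a.e. on `(−∞,0) × B_R`, for every `R`
  have hslab : ∀ R : ℝ, 0 < R →
      ∀ᵐ z ∂(volume.restrict (Iio (0 : ℝ) ×ˢ ball (0 : EuclideanSpace ℝ (Fin 3)) R)), F z = 0 := by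
    intro R hR
    have h1 : ∫⁻ t in Iio (0 : ℝ), G R t = 0 := by
      refine lintegral_Iio_eq_zero_of_period_windows hP fun k => ?_
      rw [hJ R k, hJzero R hR]
    have h2 : ∫⁻ z in Iio (0 : ℝ) ×ˢ ball (0 : EuclideanSpace ℝ (Fin 3)) R, F z = 0 := by
      rw [setLIntegral_prod_eq (hFmeas' _ _ Subset.rfl)]
      exact h1
    exact (lintegral_eq_zero_iff' (hFmeas' _ _ Subset.rfl)).1 h2
  -- union over `R = n + 1`
  have hU : (⋃ n : ℕ, Iio (0 : ℝ) ×ˢ ball (0 : EuclideanSpace ℝ (Fin 3)) ((n : ℝ) + 1)) =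
      Iio (0 : ℝ) ×ˢ (univ : Set (EuclideanSpace ℝ (Fin 3))) := by
    rw [← prod_iUnion]
    congr 1
    refine eq_univ_of_forall fun y => mem_iUnion.2 ?_
    obtain ⟨n, hn⟩ := exists_nat_gt ‖y‖
    exact ⟨n, mem_ball_zero_iff.2 (hn.trans (lt_add_one _))⟩
  have hF0 : ∀ᵐ z ∂(volume.restrict (Iio (0 : ℝ) ×ˢ (univ : Set (EuclideanSpace ℝ (Fin 3))))), F z = 0 := by
    rw [← hU, ae_restrict_iUnion_iff]
    intro n
    exact hslab _ (by positivity)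
  filter_upwards [hF0] with z hz
  have h1 : frobeniusNormSq (H z.1 z.2) ≤ 0 := ENNReal.ofReal_eq_zero.1 hz
  have h2 : ‖H z.1 z.2‖ ^ 2 ≤ 0 := (sq_opNorm_le_frobeniusNormSq _).trans h1
  exact norm_eq_zero.1 (by nlinarith [norm_nonneg (H z.1 z.2)])

/-- The `A`-part of the gauge as a scaled local-energy bound (private copy of
`hasScaledLocalEnergyBound_of_gauge` from `…Irrotational.lean`, kept here so that this file does not
sit in the route's import cone). [folklore] -/
private theorem hasScaledLocalEnergyBound_of_gauge' {ρ : ℝ}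
    {u : ℝ → EuclideanSpace ℝ (Fin 3) → EuclideanSpace ℝ (Fin 3)} {p : ℝ → EuclideanSpace ℝ (Fin 3) → ℝ}
    {H : ℝ → EuclideanSpace ℝ (Fin 3) → EuclideanSpace ℝ (Fin 3) →L[ℝ] EuclideanSpace ℝ (Fin 3)} {c : ℝ≥0}
    (hc : ∀ a : ℝ, 0 < a → ENNReal.ofReal (a ^ (2 * ρ)) * cknA a (0 : ℝ × EuclideanSpace ℝ (Fin 3)) u +
        ENNReal.ofReal (a ^ ρ) * cknE a (0 : ℝ × EuclideanSpace ℝ (Fin 3)) H +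
        ENNReal.ofReal (a ^ (2 * ρ)) * cknD a (0 : ℝ × EuclideanSpace ℝ (Fin 3)) p ≤ (c : ℝ≥0∞)) :
    Seregin2023.HasScaledLocalEnergyBound (1 - 2 * ρ) c u := by
  intro a ha s hs
  have hAterm : ENNReal.ofReal (a ^ (2 * ρ)) * cknA a (0 : ℝ × EuclideanSpace ℝ (Fin 3)) u ≤ (c : ℝ≥0∞) :=
    le_trans (le_trans le_self_add le_self_add) (hc a ha)
  have hslice : (ENNReal.ofReal a)⁻¹ * ∫⁻ x in ball (0 : EuclideanSpace ℝ (Fin 3)) a, ‖u s x‖ₑ ^ 2 ≤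
      cknA a (0 : ℝ × EuclideanSpace ℝ (Fin 3)) u := by
    unfold cknA
    have hs' : s ∈ Ioo ((0 : ℝ × EuclideanSpace ℝ (Fin 3)).1 - a ^ 2) (0 : ℝ × EuclideanSpace ℝ (Fin 3)).1 := by
      simpa using hs
    exact le_iSup₂ (f := fun t (_ : t ∈ Ioo ((0 : ℝ × EuclideanSpace ℝ (Fin 3)).1 - a ^ 2)
      (0 : ℝ × EuclideanSpace ℝ (Fin 3)).1) =>
      (ENNReal.ofReal a)⁻¹ * ∫⁻ x in ball (0 : ℝ × EuclideanSpace ℝ (Fin 3)).2 a, ‖u t x‖ₑ ^ 2) s hs'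
  have hB0 : ENNReal.ofReal (a ^ (2 * ρ)) ≠ 0 := by
    rw [ENNReal.ofReal_ne_zero_iff]; exact Real.rpow_pos_of_pos ha _
  have hA0 : ENNReal.ofReal a ≠ 0 := by rw [ENNReal.ofReal_ne_zero_iff]; exact ha
  have h2 : ENNReal.ofReal (a ^ (2 * ρ)) *
      ((ENNReal.ofReal a)⁻¹ * ∫⁻ x in ball (0 : EuclideanSpace ℝ (Fin 3)) a, ‖u s x‖ₑ ^ 2) ≤ (c : ℝ≥0∞) :=
    le_trans (mul_le_mul_right hslice _) hAterm
  have h3 : ∫⁻ x in ball (0 : EuclideanSpace ℝ (Fin 3)) a, ‖u s x‖ₑ ^ 2 ≤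
      ENNReal.ofReal a * (ENNReal.ofReal (a ^ (2 * ρ)))⁻¹ * (c : ℝ≥0∞) := by
    have key : ∫⁻ x in ball (0 : EuclideanSpace ℝ (Fin 3)) a, ‖u s x‖ₑ ^ 2 =
        ENNReal.ofReal a * (ENNReal.ofReal (a ^ (2 * ρ)))⁻¹ *
          (ENNReal.ofReal (a ^ (2 * ρ)) *
            ((ENNReal.ofReal a)⁻¹ * ∫⁻ x in ball (0 : EuclideanSpace ℝ (Fin 3)) a, ‖u s x‖ₑ ^ 2)) := by
      rw [← mul_assoc, mul_assoc (ENNReal.ofReal a), ENNReal.inv_mul_cancel hB0 ENNReal.ofReal_ne_top,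
        mul_one, ← mul_assoc, ENNReal.mul_inv_cancel hA0 ENNReal.ofReal_ne_top, one_mul]
    rw [key]
    exact mul_le_mul_right h2 _
  refine le_trans h3 (le_of_eq ?_)
  rw [← ENNReal.ofReal_inv_of_pos (Real.rpow_pos_of_pos ha _), ← ENNReal.ofReal_mul ha.le,
    ENNReal.coe_nnreal_eq, ← ENNReal.ofReal_mul (by positivity)]
  congr 1
  rw [mul_comm, Real.rpow_sub ha, Real.rpow_one, div_eq_mul_inv]

/-! ## The periodic stratum of the crux -/

/-- **Members of the power-gauged class with time-periodic weak gradient vanish** (every `ρ > −1`).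
Let `u` have weak spatial gradient `H` on `(−∞,0) × ℝ³` with the gauge
`a^{2ρ} A(a) + a^ρ E(a) + a^{2ρ} D(a) ≤ c` at the origin for all `a > 0`, and let `H` be time-periodic,
`H(t − P, ·) = H(t, ·)` for `t < 0` (`P > 0`).  Then `u = 0` a.e. on the slab: `H = 0` a.e.
(`weakGradient_ae_zero_of_gaugeE_periodic`), so a.e. slice of `u` is a.e. constant (tree
`PowerGaugeSteady.ae_slice_const_of_weakGradient_ae_zero`), and the `A`-gauge kills constants
(`const_slice_eq_zero_of_scaledLocalEnergyBound`).  No Euler equation, pressure or suitability is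
used; the steady stratum (`powerGaugeEulerLiouville_steady`, ns-typeII-p1) is the case of every period.
[folklore] -/
theorem ae_eq_zero_of_gauge_of_periodicGradient {ρ : ℝ} (hρ : -1 < ρ)
    {u : ℝ → EuclideanSpace ℝ (Fin 3) → EuclideanSpace ℝ (Fin 3)} {p : ℝ → EuclideanSpace ℝ (Fin 3) → ℝ}
    {H : ℝ → EuclideanSpace ℝ (Fin 3) → EuclideanSpace ℝ (Fin 3) →L[ℝ] EuclideanSpace ℝ (Fin 3)} {c : ℝ≥0}
    (hH : HasWeakSpatialGradientOn (slab (EuclideanSpace ℝ (Fin 3)) (Iio 0) isOpen_Iio) u H)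
    (hc : ∀ a : ℝ, 0 < a → ENNReal.ofReal (a ^ (2 * ρ)) * cknA a (0 : ℝ × EuclideanSpace ℝ (Fin 3)) u +
        ENNReal.ofReal (a ^ ρ) * cknE a (0 : ℝ × EuclideanSpace ℝ (Fin 3)) H +
        ENNReal.ofReal (a ^ (2 * ρ)) * cknD a (0 : ℝ × EuclideanSpace ℝ (Fin 3)) p ≤ (c : ℝ≥0∞))
    {P : ℝ} (hP : 0 < P) (hper : ∀ t : ℝ, t < 0 → ∀ x, H (t - P) x = H t x) :
    uncurry u =ᵐ[volume.restrict (Iio (0 : ℝ) ×ˢ (univ : Set (EuclideanSpace ℝ (Fin 3))))] 0 := by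
  have hE : ∀ a : ℝ, 0 < a →
      ENNReal.ofReal (a ^ ρ) * cknE a (0 : ℝ × EuclideanSpace ℝ (Fin 3)) H ≤ (c : ℝ≥0∞) :=
    fun a ha => le_trans (le_trans le_add_self le_self_add) (hc a ha)
  have hA := hasScaledLocalEnergyBound_of_gauge' hc
  have hHmeas : AEStronglyMeasurable (uncurry H)
      (volume.restrict (Iio (0 : ℝ) ×ˢ (univ : Set (EuclideanSpace ℝ (Fin 3))))) := by
    have := hH.locallyIntegrableOn_grad.aestronglyMeasurable
    simpa [slab] using this
  have h0 := weakGradient_ae_zero_of_gaugeE_periodic hρ hHmeas hE hP hper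
  have hslice := PowerGaugeSteady.ae_slice_const_of_weakGradient_ae_zero isOpen_Iio hH h0
  have ht0 : ∀ᵐ t ∂(volume.restrict (Iio (0 : ℝ))), t < 0 := by
    rw [ae_restrict_iff' measurableSet_Iio]; exact Eventually.of_forall fun t ht => ht
  have hzero : ∀ᵐ t ∂(volume.restrict (Iio (0 : ℝ))), u t =ᵐ[volume] 0 := by
    filter_upwards [hslice, ht0] with t ht htlt
    obtain ⟨b, hb⟩ := ht
    have hb0 : b = 0 :=
      const_slice_eq_zero_of_scaledLocalEnergyBound (m₁ := 1 - 2 * ρ) (by linarith) hA htlt hb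
    rw [hb0] at hb
    exact hb
  -- Tonelli on the slab
  have hmeas : AEStronglyMeasurable (uncurry u)
      (volume.restrict (Iio (0 : ℝ) ×ˢ (univ : Set (EuclideanSpace ℝ (Fin 3))))) := by
    have := hH.locallyIntegrableOn.aestronglyMeasurable
    simpa [slab] using this
  have hint : ∫⁻ z in Iio (0 : ℝ) ×ˢ (univ : Set (EuclideanSpace ℝ (Fin 3))), ‖uncurry u z‖ₑ = 0 := by
    have hm := hmeas.aemeasurable.enorm
    rw [Measure.volume_eq_prod, ← Measure.restrict_prod_eq_prod_univ] at hm ⊢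
    rw [lintegral_prod _ hm]
    have hz : (fun t : ℝ => ∫⁻ y, ‖uncurry u (t, y)‖ₑ) =ᵐ[volume.restrict (Iio 0)] 0 := by
      filter_upwards [hzero] with t ht
      have : (fun y => ‖uncurry u (t, y)‖ₑ) =ᵐ[volume] fun _ => 0 := by
        filter_upwards [ht] with y hy
        simp [uncurry, hy]
      rw [lintegral_congr_ae this]
      simp
    rw [lintegral_congr_ae hz]
    simp
  have hae := (lintegral_eq_zero_iff' hmeas.aemeasurable.enorm).1 hint
  filter_upwards [hae] with z hz
  simpa using hz

/-- **The time-periodic stratum of the crux `PowerGaugeEulerLiouville`, in the crux's binder shape**: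
the crux VERBATIM with the one extra hypothesis that the weak gradient is time-periodic with some
period `P > 0` on the ancient slab (suitability is not used). [folklore] -/
theorem powerGaugeEulerLiouville_periodic :
    ∀ ρ : ℝ, 0 < ρ → ∀ (u : ℝ → EuclideanSpace ℝ (Fin 3) → EuclideanSpace ℝ (Fin 3))
      (p : ℝ → EuclideanSpace ℝ (Fin 3) → ℝ)
      (H : ℝ → EuclideanSpace ℝ (Fin 3) → EuclideanSpace ℝ (Fin 3) →L[ℝ] EuclideanSpace ℝ (Fin 3)) (c : ℝ≥0),
      IsSuitableWeakSolutionOn (slab (EuclideanSpace ℝ (Fin 3)) (Set.Iio 0) isOpen_Iio) 0 0 u p →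
      HasWeakSpatialGradientOn (slab (EuclideanSpace ℝ (Fin 3)) (Set.Iio 0) isOpen_Iio) u H →
      (∀ a : ℝ, 0 < a → ENNReal.ofReal (a ^ (2 * ρ)) * cknA a (0 : ℝ × EuclideanSpace ℝ (Fin 3)) u +
        ENNReal.ofReal (a ^ ρ) * cknE a (0 : ℝ × EuclideanSpace ℝ (Fin 3)) H +
        ENNReal.ofReal (a ^ (2 * ρ)) * cknD a (0 : ℝ × EuclideanSpace ℝ (Fin 3)) p ≤ (c : ℝ≥0∞)) →
      (∃ P : ℝ, 0 < P ∧ ∀ t : ℝ, t < 0 → ∀ x, H (t - P) x = H t x) →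
      Function.uncurry u =ᵐ[volume.restrict (Set.Iio (0 : ℝ) ×ˢ (Set.univ : Set (EuclideanSpace ℝ (Fin 3))))] 0 :=
  fun _ hρ _ _ _ _ _ hH hc ⟨_, hP, hper⟩ => ae_eq_zero_of_gauge_of_periodicGradient (by linarith) hH hc hP hper

end Summit.NavierStokesRegularity.NavierStokesRegularity.Theorems.PowerGaugeEulerLiouville

end
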